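import Literature.AnabelianGeometry.AbsoluteAnabelian.AbsTopIThm26iii
import Literature.AnabelianGeometry.AbsoluteAnabelian.FreeProlRankLinearProofs
import Literature.NumberTheory.GaloisRepresentations.ContinuousH2
import HarnessLib

/-!
# [AbsTopI] Thm 2.6 (iii): plumbing between `δ²_l`, continuous `2`-cocycles and characters

S. Mochizuki, *Topics in Absolute Anabelian Geometry I: Generalities* (2012) [AbsTopI], Thm 2.6,
manuscript p. 21 (the invariants `δʲ_l(H) := dim_{ℚ_l} Hʲ(H, ℚ_l)`) and the proof of (iii) p. 23.

PROOF-ONLY file (no definitions, no named facts) of the abc-iut row «HOOK-FROM-SIGMA-STAR»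
(abc-iut-L4-lead RULING #8j (6)), preparing the derivation of the Lemma 2.7 (iii) step
(`FundamentalExtension.Lem27iiiStep`, abc-iut-w6-d073) from condition (∗)_Σ: the element-level
readings of the typed invariant `deltaInv G 2 l` (`= dim_{ℚ_l} H²_cont(G, ℚ_l)`, Mathlib's
`continuousCohomology` of the trivial representation on `ULift ℚ_l`) in both directions —
* `forall_twoCocycle_exists_of_deltaInv_two_eq_zero`: `δ²_l(G) = 0` ⇒ every continuous `ℚ_l`-valued
  `2`-cocycle is the coboundary of a continuous cochain (via the tree's `ContinuousH2.lean`: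
  `twoCocycleClass`, `twoCocycleClass_eq_zero_iff`);
* `one_le_deltaInv_two_of_twoCocycleClass_ne_zero`: a continuous `2`-cocycle with non-zero class gives
  `δ²_l(G) ≥ 1`;
— together with `exists_continuous_additive_ne_zero_of_one_le_freeProlRank` (`δ¹_l(G) ≥ 1` ⇒ a
non-zero continuous additive character `G → ℚ_l`) and `finite_submodule_of_continuous_additive`
(the continuous additive `ℚ_l`-valued functions on a topologically finitely generated group span a
finite-dimensional space: they are determined by their values on the generators).
HONEST FRAMING: classical profinite bookkeeping; refereed, undisputed paper; seat abc-iut-w6-d074;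
nothing here bears on [IUTchIII] Cor. 3.12.
-/

noncomputable section

namespace Literature.AnabelianGeometry.AbsoluteAnabelian

open Literature.NumberTheory.GaloisRepresentations

universe u

variable {G : Type u} [Group G] [TopologicalSpace G] [IsTopologicalGroup G]

/-- **`δ²_l(G) = 0` at cochain level**: if `deltaInv G 2 l = 0` (the `ℚ_l`-dimension of
`H²_cont(G, ℚ_l)` vanishes) then every continuous `ℚ_l`-valued inhomogeneous `2`-cocycle `c` of `G`
(trivial action: `c(h, k) + c(g, hk) = c(gh, k) + c(g, h)`) is the coboundary
`c(g, h) = b(h) - b(gh) + b(g)` of a continuous cochain `b`.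
[cite: MochizukiAbsTopI2012, Thm 2.6 p.21] -/
theorem forall_twoCocycle_exists_of_deltaInv_two_eq_zero [LocallyCompactSpace G] (l : ℕ)
    [Fact l.Prime] (h : deltaInv G 2 l = 0) (c : G × G → ℚ_[l]) (hc : Continuous c)
    (hcoc : ∀ g h k : G, c (h, k) + c (g, h * k) = c (g * h, k) + c (g, h)) :
    ∃ b : G → ℚ_[l], Continuous b ∧ ∀ g h : G, c (g, h) = b h - b (g * h) + b g := by
  set X : TopRep.{u} ℚ_[l] G :=
    TopRep.of (ContRepresentation.trivial ℚ_[l] G (ULift.{u} ℚ_[l])) with hX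
  let F : C(G × G, X) := ⟨fun p => ULift.up (c p), continuous_uliftUp.comp hc⟩
  have hF : F ∈ contTwoCocycles X := by
    rw [mem_contTwoCocycles_iff]
    intro σ τ υ
    change F (τ, υ) + F (σ, τ * υ) = F (σ * τ, υ) + F (σ, τ)
    apply ULift.ext
    exact hcoc σ τ υ
  have hrank : Module.rank ℚ_[l] (continuousCohomology 2 X) = 0 := by
    unfold deltaInv at h
    rwa [Cardinal.toENat_eq_zero] at h
  have h0 : twoCocycleClass X ⟨F, hF⟩ = 0 := rank_zero_iff_forall_zero.1 hrank _
  rw [twoCocycleClass_eq_zero_iff] at h0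
  obtain ⟨b, hb⟩ := h0
  refine ⟨fun g => (b g).down, continuous_uliftDown.comp b.continuous, fun g k => ?_⟩
  have hgk := hb g k
  change F (g, k) = b k - b (g * k) + b g at hgk
  exact congrArg ULift.down hgk

/-- **A continuous `2`-cocycle with non-zero class gives `δ²_l(G) ≥ 1`.**
[cite: MochizukiAbsTopI2012, Thm 2.6 p.21] -/
theorem one_le_deltaInv_two_of_twoCocycleClass_ne_zero [LocallyCompactSpace G] (l : ℕ) [Fact l.Prime]
    (f : contTwoCocycles (TopRep.of (ContRepresentation.trivial ℚ_[l] G (ULift.{u} ℚ_[l]))))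
    (hf : twoCocycleClass _ f ≠ 0) : 1 ≤ deltaInv G 2 l := by
  unfold deltaInv
  refine Order.one_le_iff_ne_zero.2 fun h0 => ?_
  rw [Cardinal.toENat_eq_zero] at h0
  exact hf (rank_zero_iff_forall_zero.1 h0 _)

omit [IsTopologicalGroup G] in
/-- **`δ¹_l(G) ≥ 1` ⇒ a non-zero continuous additive character `G → ℚ_l`** (the first coordinate of
a continuous surjection `G ↠ ℤ_l`, read in `ℚ_l`). [cite: MochizukiAbsTopI2012, Thm 2.6 p.21] -/
theorem exists_continuous_additive_ne_zero_of_one_le_freeProlRank (l : ℕ) [Fact l.Prime]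
    (h : 1 ≤ freeProlRank G l) :
    ∃ φ : G → ℚ_[l], Continuous φ ∧ (∀ g k : G, φ (g * k) = φ g + φ k) ∧ ∃ g : G, φ g ≠ 0 := by
  obtain ⟨ψ, hψ⟩ := exists_linearIndependent_of_le_freeProlRank (H := G) l (n := 1)
    (by exact_mod_cast h)
  refine ⟨fun g => ((Multiplicative.toAdd (ψ 0 g) : ℤ_[l]) : ℚ_[l]),
    continuous_subtype_val.comp (continuous_toAdd.comp (ψ 0).continuous), fun g k => ?_, ?_⟩
  · simp only [map_mul, toAdd_mul, PadicInt.coe_add]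
  · have hne := hψ.ne_zero 0
    by_contra hall
    push Not at hall
    exact hne (funext hall)

omit [IsTopologicalGroup G] in
/-- **Continuous additive `ℚ_l`-valued functions on a topologically finitely generated group form a
finite-dimensional space**: such a function is determined by its values on a finite set of topological
generators (it vanishes on the dense subgroup they generate as soon as it vanishes on them), so any
submodule of them embeds into `ℚ_l^s`. [cite: MochizukiAbsTopI2012, Thm 2.6 (ii) p.21] -/
theorem finite_submodule_of_continuous_additive [IsTopologicalGroup G] [T2Space G]
    (hG : IsTopologicallyFinitelyGenerated G) (l : ℕ) [Fact l.Prime]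
    (V : Submodule ℚ_[l] (G → ℚ_[l]))
    (hV : ∀ v ∈ V, Continuous v ∧ ∀ a b : G, v (a * b) = v a + v b) :
    Module.Finite ℚ_[l] V := by
  classical
  obtain ⟨s, hs⟩ := hG.exists_finset
  -- restriction to the generators
  let T : V →ₗ[ℚ_[l]] (s → ℚ_[l]) :=
    (LinearMap.funLeft ℚ_[l] ℚ_[l] (Subtype.val : s → G)).comp V.subtype
  have hT : ∀ (v : V) (a : s), T v a = (v : G → ℚ_[l]) a := fun _ _ => rfl
  refine Module.Finite.of_injective T fun v w hvw => ?_
  -- `d := v - w` is continuous, additive and vanishes on `s`, hence everywhere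
  have hd := hV _ (v - w).2
  set d : G → ℚ_[l] := ((v - w : V) : G → ℚ_[l]) with hddef
  have hds : ∀ a : s, d a = 0 := fun a => by
    have := congrFun hvw a
    rw [hT, hT] at this
    rw [hddef, Submodule.coe_sub, Pi.sub_apply, this, sub_self]
  have hd1 : d 1 = 0 := by
    have := hd.2 1 1
    rw [mul_one] at this
    linear_combination (-1 : ℚ_[l]) * this
  have hdinv : ∀ a : G, d a⁻¹ = -d a := fun a => by
    have := hd.2 a a⁻¹
    rw [mul_inv_cancel, hd1] at this
    linear_combination (-1 : ℚ_[l]) * this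
  have hclos : ∀ a ∈ Subgroup.closure (s : Set G), d a = 0 := by
    intro a ha
    induction ha using Subgroup.closure_induction with
    | mem x hx => exact hds ⟨x, hx⟩
    | one => exact hd1
    | mul x y _ _ hx hy => rw [hd.2, hx, hy, add_zero]
    | inv x _ hx => rw [hdinv, hx, neg_zero]
  have hdense : Dense ((Subgroup.closure (s : Set G)) : Set G) := by
    rw [dense_iff_closure_eq, ← Subgroup.topologicalClosure_coe, hs, Subgroup.coe_top]
  have hzero : d = fun _ => 0 :=
    Continuous.ext_on hdense hd.1 continuous_const fun a ha => hclos a ha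
  apply Subtype.ext
  have : ((v - w : V) : G → ℚ_[l]) = 0 := by rw [← hddef, hzero]; rfl
  rwa [Submodule.coe_sub, sub_eq_zero] at this

omit [IsTopologicalGroup G] in
/-- A subgroup is bicontinuously isomorphic to its image under an isomorphism of topological groups.
[cite: MochizukiAbsTopI2012, Thm 2.6 p.21] -/
theorem nonempty_continuousMulEquiv_subgroup_map_equiv {H : Type u} [Group H] [TopologicalSpace H]
    (e : G ≃ₜ* H) (U : Subgroup G) : Nonempty (↥U ≃ₜ* ↥(U.map (e : G →* H))) := by
  have hmem : ∀ x : U, e (x : G) ∈ U.map (e : G →* H) := fun x =>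
    Subgroup.mem_map_of_mem (e : G →* H) x.2
  have hmem' : ∀ y : U.map (e : G →* H), e.symm (y : H) ∈ U := fun y => by
    obtain ⟨x, hx, hxy⟩ := Subgroup.mem_map.mp y.2
    rw [show e.symm (y : H) = x by rw [← hxy]; exact e.symm_apply_apply x]; exact hx
  exact ⟨{ toFun := fun x => ⟨e (x : G), hmem x⟩
           invFun := fun y => ⟨e.symm (y : H), hmem' y⟩
           left_inv := fun x => Subtype.ext (e.symm_apply_apply (x : G))
           right_inv := fun y => Subtype.ext (e.apply_symm_apply (y : H))
           map_mul' := fun x y => Subtype.ext (map_mul e _ _)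
           continuous_toFun := (e.continuous.comp continuous_subtype_val).subtype_mk _
           continuous_invFun := (e.symm.continuous.comp continuous_subtype_val).subtype_mk _ }⟩

end Literature.AnabelianGeometry.AbsoluteAnabelian
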